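import Literature.MeasureTheory.Group.InvariantQuotientAdaptedUnfoldingBound   -- ★ p849197: `measure_image_mk_mul_le_unfoldingConstant_mul`, `measure_image_mk_mul_singleton_lt_top`
import Literature.MeasureTheory.Group.SubgroupRelIndexMeasure                  -- ★ `measure_subgroup_eq_relIndex_mul_of_isCompact`, `relIndex_ne_zero_of_isCompact_of_isOpen`
import Mathlib.Topology.Algebra.OpenSubgroup
import HarnessLib

/-!
# Shell sums: `μ(⋃_{j ≥ j₀} ⋃_{q < N_j} π(K·x_{jq})) < ∞` from per-level index data — the TAIL ESTIMATE of Ranga Rao's convergence theorem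
(Ranga Rao, Ann. of Math. 96 (1972), Theorem p. 505; Harish-Chandra, *Admissible invariant distributions* (1999) §3.1; Deitmar–Echterhoff (2014), Thm. 1.5.3)

Topic `MeasureTheory/Group`; namespace `Literature.MeasureTheory.Group`.  THEOREMS ONLY (no definition, no instance, no notation, no named fact, no `sorry`).
Setting of ★ `InvariantQuotientAdaptedUnfoldingBound` (p849197): `G` locally compact second countable Hausdorff, `H ≤ G` closed with a left-invariant measure `ρ` finite on
compacts (positive on opens where stated), `μ` a `G`-invariant measure on `G ⧸ H` finite on compacts, `ν` a Haar measure on `G` (right invariant where stated),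
`c = unfoldingConstant H ρ μ ν`.  ★ sums the per-piece bound `μ(π(W))·ρ(S) ≤ c·ν(W)` (`W·S ⊆ W`) for the ONE-PARAMETER family `W_j = K a^j` (chain doubling); this sequel
is the generic (III)∕(IV) junction for families whose levels are NOT single translates (the REGULAR unipotent class of `U(3)`: `N_j` translates `K·x_{jq}` per level with a
growing transversal) — it sums the per-piece bound against ARBITRARY index data, with no residue-field cardinalities anywhere.

* §1 `measure_image_mk_le_mul_div` — `μ(π W) ≤ c·ν(W) ∕ ρ(S)`.
* §2 `measure_iUnion_image_mk_lt_top_of_tsum_ne_top` — countable adapted family, `Σ_i ν(W_i) ∕ ρ(S_i) < ∞ ⇒ μ(⋃_i π(W_i)) < ∞`.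
* §3 `measure_iUnion_image_mk_lt_top_of_index_bound` — INDEX form: `ν(W_j) ≤ Nw_j·ν(K₀)`, `Ns_j·ρ(S₀) ≤ ρ(S_j)`, `Nw_j·2^{g_j} ≤ C·Ns_j`, `Σ 2^{−g_j} < ∞ ⇒ μ(⋃ π(W_j)) < ∞`;
  `tsum_two_inv_pow_div_two_ne_top` (`Σ_j 2^{−⌊j∕2⌋} = 4`).
* §4 `measure_image_mk_lt_top_of_isCompact` (a compact `W` has `μ(π W) < ∞`: finitely many right `K`-translates).
* §5 **`measure_biUnion_image_mk_mul_lt_top_of_shells`** — THE SHELLS INTERFACE (cell `pub/hodgecm-mathlib`, crux H413 `stmt-HodgeConjecture-24833`, line LH4, organ ‹RAO›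
  RAO-CONV, cut (B) of LH5-p02 (g2) 2026-09-02, consumed by the REGULAR and the TRANSVECTION case files alike): levels `j ≥ j₀`, `N j` translates `K·x j q`, compact
  subgroups `S j ≤ H` above the open `S j₀`, ABSORPTION `K·x j q·S j ⊆ K·x j q`, GROWTH `N j·2^{⌊(j−2j₀)∕2⌋} ≤ c₃·[S j : S j₀]` ⇒ `μ(⋃⋃ π(K·x j q)) < ∞`
  (`ρ`, `ν` parameters as in ★; `…_of_shells'` builds `ρ :=` Haar on `H` inside).
* §6 `measure_biUnion_image_mk_lt_top_of_tail` — assembly over `{j ∣ j₀ ≤ j}` from «every level finite» + «`ℕ`-tail finite».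
HONEST LABEL: generic measure theory, count-neutral; HC_CM is proved only modulo the 7 printed citations (2 remaining: hLiu418 = stmt-HodgeConjecture-24832, h413 =
stmt-HodgeConjecture-24833) until rung 0 closes.

## References
* [Rao1972] R. Ranga Rao, *Orbital integrals in reductive groups*, Ann. of Math. (2) 96 (1972) 505–510, Theorem p. 505.
* [HarishChandra1999AdmissibleDistributions] Harish-Chandra, *Admissible Invariant Distributions on Reductive p-adic Groups*, AMS ULS 16 (1999), §3.1 p. 17.
* [DeitmarEchterhoff2014] A. Deitmar, S. Echterhoff, *Principles of Harmonic Analysis*, 2nd ed. (2014), Thm. 1.5.3 (quotient integral formula).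
-/

noncomputable section

open _root_.MeasureTheory _root_.MeasureTheory.Measure _root_.Topology Set Filter
open scoped ENNReal NNReal Pointwise

namespace Literature.MeasureTheory.Group

section Adapted

variable {G : Type*} [Group G] [TopologicalSpace G] [IsTopologicalGroup G] [LocallyCompactSpace G]
  [SecondCountableTopology G] [T2Space G] [MeasurableSpace G] [BorelSpace G]
  (H : Subgroup G) [hH : IsClosed (H : Set G)]
  (ρ : Measure H) [ρ.IsMulLeftInvariant] [IsFiniteMeasureOnCompacts ρ]
  [MeasurableSpace (G ⧸ H)] [BorelSpace (G ⧸ H)]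
  (μ : Measure (G ⧸ H)) [IsFiniteMeasureOnCompacts μ] [SMulInvariantMeasure G (G ⧸ H) μ]
  (ν : Measure G) [IsHaarMeasure ν]

/-! ### §1 The per-piece bound in quotient form -/

/-- **`μ(π W) ≤ c·ν(W) ∕ ρ(S)`** for an adapted pair (`W` open, `S ⊆ H` measurable, `W·S ⊆ W`) with `0 < ρ(S) < ∞` (★
`measure_image_mk_mul_le_unfoldingConstant_mul` divided through). [cite: DeitmarEchterhoff2014, Thm. 1.5.3] -/
theorem measure_image_mk_le_mul_div {W : Set G} (hW : IsOpen W) {S : Set H} (hS : MeasurableSet S)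
    (hWS : ∀ w ∈ W, ∀ s ∈ S, w * (s : G) ∈ W) (hρ0 : ρ S ≠ 0) (hρT : ρ S ≠ ∞) :
    μ ((QuotientGroup.mk : G → G ⧸ H) '' W) ≤ unfoldingConstant H ρ μ ν * ν W / ρ S := by
  rw [ENNReal.le_div_iff_mul_le (Or.inl hρ0) (Or.inl hρT)]
  exact measure_image_mk_mul_le_unfoldingConstant_mul H ρ μ ν hW hS hWS

/-! ### §2 Countable adapted families with summable ratios -/

/-- **Summable-family unfolding bound.**  For a countable adapted family — `W_i ⊆ G` open, `S_i ⊆ H` measurable, `W_i·S_i ⊆ W_i`, `0 < ρ(S_i) < ∞` — with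
`Σ_i ν(W_i) ∕ ρ(S_i) < ∞`, the union of the images has finite measure: `μ(⋃_i π(W_i)) ≤ c · Σ_i ν(W_i) ∕ ρ(S_i) < ∞`.
[cite: Rao1972, Theorem] [cite: DeitmarEchterhoff2014, Thm. 1.5.3] -/
theorem measure_iUnion_image_mk_lt_top_of_tsum_ne_top {ι : Type*} [Countable ι] (W : ι → Set G) (hWo : ∀ i, IsOpen (W i))
    (S : ι → Set H) (hSm : ∀ i, MeasurableSet (S i)) (hWS : ∀ i, ∀ w ∈ W i, ∀ s ∈ S i, w * (s : G) ∈ W i)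
    (hρ0 : ∀ i, ρ (S i) ≠ 0) (hρT : ∀ i, ρ (S i) ≠ ∞) (hsum : ∑' i, ν (W i) / ρ (S i) ≠ ∞) :
    μ (⋃ i, (QuotientGroup.mk : G → G ⧸ H) '' W i) < ∞ := by
  refine (measure_iUnion_le _).trans_lt ?_
  calc ∑' i, μ ((QuotientGroup.mk : G → G ⧸ H) '' W i)
        ≤ ∑' i, unfoldingConstant H ρ μ ν * (ν (W i) / ρ (S i)) :=
          ENNReal.tsum_le_tsum fun i => by
            rw [← mul_div_assoc]
            exact measure_image_mk_le_mul_div H ρ μ ν (hWo i) (hSm i) (hWS i) (hρ0 i) (hρT i)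
    _ = unfoldingConstant H ρ μ ν * ∑' i, ν (W i) / ρ (S i) := ENNReal.tsum_mul_left
    _ < ∞ := ENNReal.mul_lt_top ENNReal.coe_lt_top (lt_top_iff_ne_top.2 hsum)

/-! ### §3 The index form of the tail estimate -/

/-- **`Σ_{j ≥ 0} 2^{−⌊j∕2⌋} = 4 < ∞`** — the exponent of the rank-one tail (shell count `∕` index `≤ C · 2^{−⌊j∕2⌋}`). [cite: Rao1972, Theorem] -/
theorem tsum_two_inv_pow_div_two_ne_top : ∑' j : ℕ, ((2 : ℝ≥0∞)⁻¹) ^ (j / 2) ≠ ∞ := by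
  have hgeom : ∑' k : ℕ, ((2 : ℝ≥0∞)⁻¹) ^ k = 2 := by
    rw [ENNReal.tsum_geometric, ENNReal.one_sub_inv_two, inv_inv]
  have he : ∑' k : ℕ, ((2 : ℝ≥0∞)⁻¹) ^ (2 * k / 2) = ∑' k : ℕ, ((2 : ℝ≥0∞)⁻¹) ^ k :=
    tsum_congr fun k => by rw [Nat.mul_div_cancel_left k two_pos]
  have ho : ∑' k : ℕ, ((2 : ℝ≥0∞)⁻¹) ^ ((2 * k + 1) / 2) = ∑' k : ℕ, ((2 : ℝ≥0∞)⁻¹) ^ k :=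
    tsum_congr fun k => by rw [show (2 * k + 1) / 2 = k by omega]
  have h := tsum_even_add_odd (f := fun j : ℕ => ((2 : ℝ≥0∞)⁻¹) ^ (j / 2)) ENNReal.summable ENNReal.summable
  rw [← h, he, ho, hgeom]
  norm_num

/-- **Tail estimate, index form (residue-field free).**  `ℕ`-indexed adapted family `(W_j, S_j)` (`W_j` open, `S_j ⊆ H` measurable, `W_j·S_j ⊆ W_j`) with
SHELL COUNTS `ν(W_j) ≤ Nw_j · ν(K₀)` (`ν(K₀) < ∞`), INDEX GROWTH `Ns_j · ρ(S₀) ≤ ρ(S_j)` (`0 < ρ(S₀)`, `Ns_j ≠ 0`) and the index inequality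
`Nw_j · 2^{g_j} ≤ C · Ns_j` for an exponent `g` with `Σ_j 2^{−g_j} < ∞` ⇒ `μ(⋃_j π(W_j)) < ∞`: each level costs
`μ(π(W_j)) ≤ c·ν(K₀)·C ∕ ρ(S₀) · 2^{−g_j}`. [cite: Rao1972, Theorem] [cite: HarishChandra1999AdmissibleDistributions, §3.1 p. 17] -/
theorem measure_iUnion_image_mk_lt_top_of_index_bound (W : ℕ → Set G) (hWo : ∀ j, IsOpen (W j)) (S : ℕ → Set H)
    (hSm : ∀ j, MeasurableSet (S j)) (hWS : ∀ j, ∀ w ∈ W j, ∀ s ∈ S j, w * (s : G) ∈ W j)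
    {K₀ : Set G} (hK₀ : ν K₀ ≠ ∞) {S₀ : Set H} (hS₀ : ρ S₀ ≠ 0)
    (Nw Ns : ℕ → ℕ) (C : ℕ) (g : ℕ → ℕ) (hidx : ∀ j, Nw j * 2 ^ g j ≤ C * Ns j) (hNs : ∀ j, Ns j ≠ 0)
    (hW : ∀ j, ν (W j) ≤ Nw j * ν K₀) (hS : ∀ j, (Ns j : ℝ≥0∞) * ρ S₀ ≤ ρ (S j))
    (hg : ∑' j, ((2 : ℝ≥0∞)⁻¹) ^ g j ≠ ∞) :
    μ (⋃ j, (QuotientGroup.mk : G → G ⧸ H) '' W j) < ∞ := by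
  -- per level: `μ(π W_j) · (Ns_j ρ S₀) · 2^{g_j} ≤ c ν(K₀) · C · Ns_j`
  set c : ℝ≥0∞ := (unfoldingConstant H ρ μ ν : ℝ≥0∞) with hc
  have hlevel : ∀ j, μ ((QuotientGroup.mk : G → G ⧸ H) '' W j) ≤ c * ν K₀ * C / ρ S₀ * ((2 : ℝ≥0∞)⁻¹) ^ g j := by
    intro j
    have h1 : μ ((QuotientGroup.mk : G → G ⧸ H) '' W j) * ρ (S j) ≤ c * ν (W j) :=
      measure_image_mk_mul_le_unfoldingConstant_mul H ρ μ ν (hWo j) (hSm j) (hWS j)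
    -- `μ(π W_j) · Ns_j · ρ S₀ · 2^{g_j} ≤ c · ν K₀ · (Nw_j · 2^{g_j}) ≤ c · ν K₀ · C · Ns_j`
    have h2 : μ ((QuotientGroup.mk : G → G ⧸ H) '' W j) * ((Ns j : ℝ≥0∞) * ρ S₀) * 2 ^ g j ≤
        c * ν K₀ * (C * Ns j : ℕ) := by
      calc μ ((QuotientGroup.mk : G → G ⧸ H) '' W j) * ((Ns j : ℝ≥0∞) * ρ S₀) * 2 ^ g j
            ≤ μ ((QuotientGroup.mk : G → G ⧸ H) '' W j) * ρ (S j) * 2 ^ g j := by gcongr; exact hS j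
        _ ≤ c * ν (W j) * 2 ^ g j := by gcongr
        _ ≤ c * (Nw j * ν K₀) * 2 ^ g j := by gcongr; exact hW j
        _ = c * ν K₀ * ((Nw j * 2 ^ g j : ℕ) : ℝ≥0∞) := by push_cast; ring
        _ ≤ c * ν K₀ * ((C * Ns j : ℕ) : ℝ≥0∞) := mul_le_mul' le_rfl (by exact_mod_cast hidx j)
    -- cancel `Ns_j` and divide by `ρ S₀ · 2^{g_j}`
    have hNs0 : ((Ns j : ℕ) : ℝ≥0∞) ≠ 0 := Nat.cast_ne_zero.2 (hNs j)
    have hNsT : ((Ns j : ℕ) : ℝ≥0∞) ≠ ∞ := ENNReal.natCast_ne_top _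
    have h2j : (2 : ℝ≥0∞) ^ g j ≠ 0 := pow_ne_zero _ two_ne_zero
    have h2j' : (2 : ℝ≥0∞) ^ g j ≠ ∞ := ENNReal.pow_ne_top ENNReal.ofNat_ne_top
    have h3 : μ ((QuotientGroup.mk : G → G ⧸ H) '' W j) * (ρ S₀ * 2 ^ g j) * (Ns j : ℝ≥0∞) ≤ c * ν K₀ * C * (Ns j : ℝ≥0∞) := by
      calc μ ((QuotientGroup.mk : G → G ⧸ H) '' W j) * (ρ S₀ * 2 ^ g j) * (Ns j : ℝ≥0∞)
            = μ ((QuotientGroup.mk : G → G ⧸ H) '' W j) * ((Ns j : ℝ≥0∞) * ρ S₀) * 2 ^ g j := by ring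
        _ ≤ c * ν K₀ * (C * Ns j : ℕ) := h2
        _ = c * ν K₀ * C * (Ns j : ℝ≥0∞) := by push_cast; ring
    have h4 : μ ((QuotientGroup.mk : G → G ⧸ H) '' W j) * (ρ S₀ * 2 ^ g j) ≤ c * ν K₀ * C :=
      (ENNReal.mul_le_mul_iff_left hNs0 hNsT).1 h3
    have h5 : μ ((QuotientGroup.mk : G → G ⧸ H) '' W j) ≤ c * ν K₀ * C / (ρ S₀ * 2 ^ g j) := by
      rw [ENNReal.le_div_iff_mul_le (Or.inl (mul_ne_zero hS₀ h2j)) (Or.inr (by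
        refine ENNReal.mul_ne_top (ENNReal.mul_ne_top ENNReal.coe_ne_top hK₀) (ENNReal.natCast_ne_top _)))]
      exact h4
    refine h5.trans (le_of_eq ?_)
    rw [div_eq_mul_inv, div_eq_mul_inv, ENNReal.mul_inv (Or.inl hS₀) (Or.inr h2j), ENNReal.inv_pow]
    ring
  refine (measure_iUnion_le _).trans_lt ?_
  calc ∑' j, μ ((QuotientGroup.mk : G → G ⧸ H) '' W j)
        ≤ ∑' j, c * ν K₀ * C / ρ S₀ * ((2 : ℝ≥0∞)⁻¹) ^ g j := ENNReal.tsum_le_tsum hlevel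
    _ = c * ν K₀ * C / ρ S₀ * ∑' j, ((2 : ℝ≥0∞)⁻¹) ^ g j := ENNReal.tsum_mul_left
    _ < ∞ := by
        refine ENNReal.mul_lt_top (ENNReal.div_lt_top ?_ hS₀) (lt_top_iff_ne_top.2 hg)
        exact ENNReal.mul_ne_top (ENNReal.mul_ne_top ENNReal.coe_ne_top hK₀) (ENNReal.natCast_ne_top _)

/-! ### §4 Compact pieces -/

variable [ρ.IsOpenPosMeasure]

include ρ ν in
/-- **A compact `W ⊆ G` has `μ(π(W)) < ∞`**: `W` is covered by finitely many right translates `K g` of a compact open subgroup `K` (`g ∈ W`), each of finite image measure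
(★ `measure_image_mk_mul_singleton_lt_top`). [cite: DeitmarEchterhoff2014, Thm. 1.5.3] -/
theorem measure_image_mk_lt_top_of_isCompact (K : Subgroup G) (hKo : IsOpen (K : Set G)) (hKc : IsCompact (K : Set G))
    {W : Set G} (hW : IsCompact W) :
    μ ((QuotientGroup.mk : G → G ⧸ H) '' W) < ∞ := by
  -- the open cover of `W` by the cosets `K g`, `g ∈ W`
  obtain ⟨t, htW, hcover⟩ := hW.elim_nhds_subcover (fun g => (K : Set G) * {g}) fun g _ => by
    rw [Set.mul_singleton]
    exact ((Homeomorph.mulRight g).isOpenMap _ hKo).mem_nhds ⟨1, K.one_mem, by simp⟩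
  have hfin : μ (⋃ g ∈ t, (QuotientGroup.mk : G → G ⧸ H) '' ((K : Set G) * {g})) < ∞ :=
    measure_biUnion_lt_top t.finite_toSet fun g _ => measure_image_mk_mul_singleton_lt_top H ρ μ ν K hKo hKc g
  refine lt_of_le_of_lt (measure_mono ?_) hfin
  rintro _ ⟨w, hw, rfl⟩
  obtain ⟨g, hg, hwg⟩ := Set.mem_iUnion₂.1 (hcover hw)
  exact Set.mem_iUnion₂.2 ⟨g, hg, Set.mem_image_of_mem _ hwg⟩


/-! ### §5 The SHELLS form: levels `j ≥ j₀`, `N_j` right `K`-translates per level, one compact open `S_j ≤ H` per level -/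

omit [ρ.IsOpenPosMeasure] in
include ρ ν in
/-- **TAIL ESTIMATE FROM SHELL DATA** (the interface exported by the covering step of Ranga Rao's argument, measure-free on the input side).  Data: levels
`j ≥ j₀`; at level `j`, `N j` right translates `K·x j q` (`q < N j`) of the compact open subgroup `K`, and a compact subgroup `S j ≤ H` containing the OPEN
subgroup `S j₀`, with ABSORPTION `K·x j q·S j ⊆ K·x j q` and INDEX GROWTH `N j · 2^{⌊(j − 2j₀)∕2⌋} ≤ c₃·[S j : S j₀]`.  Then
`μ(⋃_{j ≥ j₀} ⋃_{q < N j} π(K·x j q)) < ∞`: per level `μ(π(K x))·ρ(S j) ≤ c·ν(K)` (★ adapted unfolding, right-invariance of `ν`), `ρ(S j) = [S j : S j₀]·ρ(S j₀)`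
(★ `measure_subgroup_eq_relIndex_mul_of_isCompact`), and `Σ_j 2^{−⌊(j−2j₀)∕2⌋} < ∞` (§3).  `ρ` is any left-invariant measure on `H` finite on compacts and
positive on opens, `ν` any right-invariant Haar measure on `G` (parameters, as in ★ `measure_iUnion_image_mk_mul_zpow_lt_top`).
[cite: Rao1972, Theorem] [cite: HarishChandra1999AdmissibleDistributions, §3.1 p. 17] [cite: DeitmarEchterhoff2014, Thm. 1.5.3] -/
theorem measure_biUnion_image_mk_mul_lt_top_of_shells [ρ.IsOpenPosMeasure] [ν.IsMulRightInvariant] (K : Subgroup G)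
    (hKo : IsOpen (K : Set G)) (hKc : IsCompact (K : Set G)) (j₀ : ℤ) (N : ℤ → ℕ) (x : ℤ → ℕ → G) (S : ℤ → Subgroup H) (c₃ : ℕ)
    (hSc : ∀ j, j₀ ≤ j → IsCompact (S j : Set H)) (hS₀ : IsOpen (S j₀ : Set H)) (hle : ∀ j, j₀ ≤ j → S j₀ ≤ S j)
    (habs : ∀ j, j₀ ≤ j → ∀ q, q < N j → ∀ k ∈ K, ∀ s ∈ S j, k * x j q * (s : G) ∈ (K : Set G) * {x j q})
    (hgr : ∀ j, j₀ ≤ j → N j * 2 ^ ((j - 2 * j₀) / 2).toNat ≤ c₃ * (S j₀).relIndex (S j)) :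
    μ (⋃ j ∈ {j : ℤ | j₀ ≤ j}, ⋃ q ∈ {q : ℕ | q < N j}, (QuotientGroup.mk : G → G ⧸ H) '' ((K : Set G) * {x j q})) < ∞ := by
  -- reindex the levels by `n : ℕ`, `j = j₀ + n`; level sets `W n` and level subgroups `T n`
  set W : ℕ → Set G := fun n => ⋃ q ∈ {q : ℕ | q < N (j₀ + n)}, (K : Set G) * {x (j₀ + n) q} with hWdef
  set T : ℕ → Set H := fun n => (S (j₀ + n) : Set H) with hTdef
  have hj : ∀ n : ℕ, j₀ ≤ j₀ + n := fun n => by omega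
  have hWo : ∀ n, IsOpen (W n) := fun n => isOpen_biUnion fun q _ => by
    rw [Set.mul_singleton]; exact (Homeomorph.mulRight _).isOpenMap _ hKo
  have hSo : ∀ n : ℕ, IsOpen (S (j₀ + n) : Set H) := fun n => Subgroup.isOpen_mono (hle _ (hj n)) hS₀
  have hTm : ∀ n, MeasurableSet (T n) := fun n => (hSo n).measurableSet
  have hWT : ∀ n, ∀ w ∈ W n, ∀ s ∈ T n, w * (s : G) ∈ W n := by
    intro n w hw s hs
    obtain ⟨q, hq, hwq⟩ := Set.mem_iUnion₂.1 hw
    rw [Set.mul_singleton] at hwq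
    obtain ⟨k, hk, rfl⟩ := hwq
    exact Set.mem_iUnion₂.2 ⟨q, hq, habs _ (hj n) q hq k hk s hs⟩
  -- shell counts `ν(W n) ≤ N · ν(K)` by right-invariance
  have hνK : ∀ g : G, ν ((K : Set G) * {g}) = ν K := fun g => by
    rw [Set.mul_singleton, Set.image_mul_right, measure_preimage_mul_right]
  have hW : ∀ n : ℕ, ν (W n) ≤ (N (j₀ + n) : ℕ) * ν K := by
    intro n
    have hWeq : W n = ⋃ q ∈ Finset.range (N (j₀ + n)), (K : Set G) * {x (j₀ + n) q} := by
      ext g; simp only [hWdef, Set.mem_iUnion, Set.mem_setOf_eq, Finset.mem_range]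
    rw [hWeq]
    refine (measure_biUnion_finset_le _ _).trans (le_of_eq ?_)
    rw [Finset.sum_congr rfl fun q _ => hνK (x (j₀ + n) q), Finset.sum_const, Finset.card_range, nsmul_eq_mul]
  -- index growth `[S j : S j₀] · ρ(S j₀) = ρ(S j)`
  have hidxρ : ∀ n : ℕ, (S j₀).relIndex (S (j₀ + n)) ≠ 0 ∧ ρ (S (j₀ + n) : Set H) = (S j₀).relIndex (S (j₀ + n)) * ρ (S j₀ : Set H) :=
    fun n => measure_subgroup_eq_relIndex_mul_of_isCompact ρ (hle _ (hj n)) (hSc _ (hj n)) (hSo n) hS₀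
  have hρ0 : ρ (S j₀ : Set H) ≠ 0 := (hS₀.measure_pos ρ ⟨1, (S j₀).one_mem⟩).ne'
  -- the exponent `⌊(j − 2j₀)∕2⌋ ≥ ⌊n∕2⌋` (`j = j₀ + n`, `j₀ ≤ 0` is not even needed: `(j₀ + n) − 2 j₀ = n − j₀ ≥ n` iff `j₀ ≤ 0`… use monotonicity only when it holds)
  have htail : μ (⋃ n, (QuotientGroup.mk : G → G ⧸ H) '' W n) < ∞ := by
    refine measure_iUnion_image_mk_lt_top_of_index_bound H ρ μ ν W hWo T hTm hWT (K₀ := (K : Set G)) hKc.measure_lt_top.ne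
      (S₀ := (S j₀ : Set H)) hρ0 (fun n => N (j₀ + n)) (fun n => (S j₀).relIndex (S (j₀ + n))) c₃
      (fun n => ((j₀ + n - 2 * j₀) / 2).toNat) (fun n => hgr _ (hj n)) (fun n => (hidxρ n).1) hW (fun n => le_of_eq (hidxρ n).2.symm) ?_
    -- summability of `2^{−⌊(n − j₀)∕2⌋₊}`: compare with `2^{−⌊n∕2⌋}` when `j₀ ≤ 0`, and with a shifted geometric tail in general
    refine ne_top_of_le_ne_top (ENNReal.mul_ne_top (ENNReal.pow_ne_top ENNReal.ofNat_ne_top : (2 : ℝ≥0∞) ^ (2 * j₀.toNat) ≠ ∞) tsum_two_inv_pow_div_two_ne_top) ?_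
    rw [← ENNReal.tsum_mul_left]
    refine ENNReal.tsum_le_tsum fun n => ?_
    -- `2^{−a} ≤ 2^{2 j₀⁺} · 2^{−⌊n∕2⌋}` where `a = ⌊(n − j₀)∕2⌋₊ ≥ ⌊n∕2⌋ − j₀⁺`
    have h2 : ((2 : ℝ≥0∞)⁻¹) ≤ 1 := ENNReal.inv_le_one.2 one_le_two
    have ha : n / 2 ≤ ((j₀ + n - 2 * j₀) / 2).toNat + 2 * j₀.toNat := by omega
    calc ((2 : ℝ≥0∞)⁻¹) ^ ((j₀ + n - 2 * j₀) / 2).toNat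
        = 2 ^ (2 * j₀.toNat) * (((2 : ℝ≥0∞)⁻¹) ^ (2 * j₀.toNat) * ((2 : ℝ≥0∞)⁻¹) ^ ((j₀ + n - 2 * j₀) / 2).toNat) := by
          rw [← mul_assoc, ← mul_pow, ENNReal.mul_inv_cancel two_ne_zero ENNReal.ofNat_ne_top, one_pow, one_mul]
      _ = 2 ^ (2 * j₀.toNat) * ((2 : ℝ≥0∞)⁻¹) ^ (((j₀ + n - 2 * j₀) / 2).toNat + 2 * j₀.toNat) := by rw [← pow_add, add_comm]
      _ ≤ 2 ^ (2 * j₀.toNat) * ((2 : ℝ≥0∞)⁻¹) ^ (n / 2) := mul_le_mul' le_rfl (pow_le_pow_right_of_le_one' h2 ha)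
  -- the original union is contained in `⋃ n, π(W n)`
  refine lt_of_le_of_lt (measure_mono ?_) htail
  intro y hy
  simp only [Set.mem_iUnion, Set.mem_setOf_eq, exists_prop] at hy
  obtain ⟨j, hj₀, q, hq, hyq⟩ := hy
  refine Set.mem_iUnion.2 ⟨(j - j₀).toNat, ?_⟩
  have hjn : j₀ + ((j - j₀).toNat : ℤ) = j := by rw [Int.toNat_of_nonneg (by omega)]; ring
  rw [hWdef]
  simp only [Set.image_iUnion, Set.mem_iUnion, Set.mem_setOf_eq, exists_prop]
  exact ⟨q, by rw [hjn]; exact hq, by rw [hjn]; exact hyq⟩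


include ν in
/-- **The same with the auxiliary measure on `H` built inside** (`ρ :=` the Haar measure of the closed, hence locally compact, subgroup `H`): the consumer supplies only
`μ` (invariant, finite on compacts) and a right-invariant Haar measure `ν` on `G`. [cite: Rao1972, Theorem] [cite: DeitmarEchterhoff2014, Thm. 1.5.3] -/
theorem measure_biUnion_image_mk_mul_lt_top_of_shells' [ν.IsMulRightInvariant] (K : Subgroup G)
    (hKo : IsOpen (K : Set G)) (hKc : IsCompact (K : Set G)) (j₀ : ℤ) (N : ℤ → ℕ) (x : ℤ → ℕ → G) (S : ℤ → Subgroup H) (c₃ : ℕ)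
    (hSc : ∀ j, j₀ ≤ j → IsCompact (S j : Set H)) (hS₀ : IsOpen (S j₀ : Set H)) (hle : ∀ j, j₀ ≤ j → S j₀ ≤ S j)
    (habs : ∀ j, j₀ ≤ j → ∀ q, q < N j → ∀ k ∈ K, ∀ s ∈ S j, k * x j q * (s : G) ∈ (K : Set G) * {x j q})
    (hgr : ∀ j, j₀ ≤ j → N j * 2 ^ ((j - 2 * j₀) / 2).toNat ≤ c₃ * (S j₀).relIndex (S j)) :
    μ (⋃ j ∈ {j : ℤ | j₀ ≤ j}, ⋃ q ∈ {q : ℕ | q < N j}, (QuotientGroup.mk : G → G ⧸ H) '' ((K : Set G) * {x j q})) < ∞ := by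
  haveI : LocallyCompactSpace H := hH.locallyCompactSpace
  exact measure_biUnion_image_mk_mul_lt_top_of_shells H Measure.haar μ ν K hKo hKc j₀ N x S c₃ hSc hS₀ hle habs hgr

end Adapted

/-! ### §6 The assembly over `{j : ℤ ∣ j₀ ≤ j}` -/

section Assembly

variable {G : Type*} [Group G] (H : Subgroup G) [MeasurableSpace (G ⧸ H)] (μ : Measure (G ⧸ H))

/-- **Assembly over the levels `j ≥ j₀`**: if every level has `μ(π(W_j)) < ∞` (e.g. `W_j` compact, §4) and the `ℕ`-tail `μ(⋃_{n ≥ 0} π(W_n)) < ∞` (§3), then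
`μ(⋃_{j ≥ j₀} π(W_j)) < ∞` for every `j₀ : ℤ`. [cite: Rao1972, Theorem] -/
theorem measure_biUnion_image_mk_lt_top_of_tail (W : ℤ → Set G) (hfin : ∀ j : ℤ, μ ((QuotientGroup.mk : G → G ⧸ H) '' W j) < ∞)
    (htail : μ (⋃ n : ℕ, (QuotientGroup.mk : G → G ⧸ H) '' W (n : ℤ)) < ∞) (j₀ : ℤ) :
    μ (⋃ j ∈ {j : ℤ | j₀ ≤ j}, (QuotientGroup.mk : G → G ⧸ H) '' W j) < ∞ := by
  have hneg : μ (⋃ j ∈ Finset.Ico j₀ 0, (QuotientGroup.mk : G → G ⧸ H) '' W j) < ∞ :=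
    measure_biUnion_lt_top (Finset.Ico j₀ 0).finite_toSet fun j _ => hfin j
  refine lt_of_le_of_lt (measure_mono ?_) ((measure_union_le _ _).trans_lt (ENNReal.add_lt_top.2 ⟨hneg, htail⟩))
  intro x hx
  simp only [Set.mem_iUnion, Set.mem_setOf_eq, exists_prop] at hx
  obtain ⟨j, hj, hxj⟩ := hx
  rcases lt_or_ge j 0 with hjneg | hjpos
  · refine Or.inl ?_
    simp only [Set.mem_iUnion, Finset.mem_Ico, exists_prop]
    exact ⟨j, ⟨hj, hjneg⟩, hxj⟩
  · refine Or.inr ?_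
    simp only [Set.mem_iUnion]
    refine ⟨j.toNat, ?_⟩
    rwa [Int.toNat_of_nonneg hjpos]

end Assembly

end Literature.MeasureTheory.Group
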